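import Mathlib.Algebra.BigOperators.Ring.Finset
import Mathlib.Algebra.BigOperators.Fin
import Mathlib.Data.Fintype.BigOperators
import Mathlib.Data.Fintype.Sum
import Mathlib.Data.Fintype.Prod
import Mathlib.Logic.Equiv.Fin.Basic
import Mathlib.Tactic.Ring
import Literature.Computability.AlgebraicComplexity.TensorSemiring
import HarnessLib

/-!
# Restriction of `d`-tensors (`k`-party tensors): the preorder, Kronecker product, direct sum, units

Topic `Literature/Computability/AlgebraicComplexity`. The tree's semiring `T(K)` of 3-tensors modulo
restriction-equivalence (`TensorSemiring.lean`, `TensorSemiringSpectrum.lean`) is the `k = 3` case of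
Strassen's theory, which Christandl–Vrana–Zuiddam state for multilinear maps of ANY order `k`:

> "The asymptotic restriction problem is a problem about multilinear maps `f : 𝔽^{n₁} × ⋯ × 𝔽^{n_k} → 𝔽`
> … one may equivalently think of `f` as the `k`-tensor `t ∈ 𝔽^{n₁} ⊗ ⋯ ⊗ 𝔽^{n_k}` … We say `f`
> restricts to `g`, and write `f ≥ g`, if there are linear maps `A_i : 𝔽^{m_i} → 𝔽^{n_i}` such that
> `g = f ∘ (A₁, …, A_k)`" [corpus: paper:arxiv-1709.07851 p0003:L5–L17 = CVZ 2023, §1.1];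
> "`f ⊗ g` … `(v₁ ⊗ w₁, …, v_k ⊗ w_k) ↦ f(v₁,…,v_k) g(w₁,…,w_k)`" [ibid. p0003:L19–L24];
> "the sum `f ⊕ g` … `(v₁ + w₁, …, v_k + w_k) ↦ f(v₁,…,v_k) + g(w₁,…,w_k)` … and the tensor `⟨n⟩` …
> maps `(e_{i₁}, …, e_{i_k})` to `1` if `i₁ = ⋯ = i_k` and to `0` otherwise" [ibid. p0003:L60–L62].

This file is the first of three answering the definition request `defn-AsymptoticSpectrumDTensors`
(asymptotic spectrum of `d`-tensors for `stmt-MatrixMultiplication-26697`): it sets up `d`-tensors in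
the coordinate format of `RankMethodBarriers.tensorRankD` and the Summit modules (`(Fin d → Fin n) → K`:
one index per leg; here an arbitrary finite index type `ι`, the same on every leg), the action of a
leg-wise family of matrices, the restriction preorder and its compatibility with the Kronecker product
and the direct sum, and the unit tensors `⟨n⟩`. The quotient semiring `DTensorClass K d` is built in
`DTensorSemiring.lean`, the Strassen-preorder axioms are proved in `DTensorStrassenPreorder.lean`.
Everything here is a definition with a body or a proved lemma; `K` is any commutative semiring; no
named facts. Grade: REFEREED (CVZ 2023 = JAMS version of arXiv:1709.07851; definitions as printed in
§1.1, specialised to coordinates).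

## Content

* `DTensor.apply A t` — `(A₀ ⊗ ⋯ ⊗ A_{d-1}) t` in coordinates, `A j : ι' × ι → K` the matrix on leg `j`:
  `(A·t) i = ∑_k (∏_j A j (i j) (k j)) · t k`; `apply_one`, functoriality `apply_apply`, additivity.
* `DTensor.Restricts t s` («`t ≥ s`»: `s = A·t` for some `A`) — reflexive, transitive, `t ≥ 0`.
* `DTensor.embedMat f` (the `0/1` matrix of a map of index sets `f : ι → κ`) and the EMBEDDING
  CALCULUS: `apply_embedMat_apply_embedMat` (`E_g (E_f t) = E_{g ∘ f} t`), `reindex e t = E_e t`,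
  `apply_embedMat_eq_self_of_leftInverse`, `restricts_precomp` (`t ↦ t ∘ (f ∘ ·)` is a restriction) —
  the uniform-in-`d` tool by which the semiring laws of the sequel become statements about maps of
  index sets rather than case splits on multi-indices.
* `DTensor.kron t t'` (`⊗`, leg-wise product of index sets), `DTensor.dsum t t'` (`⊕`, leg-wise
  disjoint union; in closed form `E_inl t + E_inr t'`), `DTensor.unit K d ι` (`⟨|ι|⟩`);
  `dsum_inl/inr/mixed`, `apply_kron`, `kron_add/add_kron`, **`Restricts.kron`**, **`Restricts.dsum`**
  (restriction is compatible with `⊗` and `⊕` — CVZ §1.2 "behave well with respect to the semiring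
  operations"), `kron_unit_unit` (`⟨ι⟩ ⊗ ⟨ι'⟩ = ⟨ι × ι'⟩`), `dsum_unit_unit` (`⟨ι⟩ ⊕ ⟨ι'⟩ = ⟨ι ⊕ ι'⟩`,
  `d ≠ 0`), `reindex_unit`, `unit_comp_of_injective`, `apply_unit` (the action on `⟨ι⟩` is a single
  sum), `restricts_unit_of_injective` (`⟨κ⟩ ≥ ⟨ι⟩` for `ι ↪ κ`).

## References

* M. Christandl, P. Vrana, J. Zuiddam, *Universal points in the asymptotic spectrum of tensors*,
  J. Amer. Math. Soc. 36 (2023) = arXiv:1709.07851, §1.1 (p. 3), §1.2 (p. 5). [ChristandlVranaZuiddam2023]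
* J. Zuiddam, *Algebraic complexity, asymptotic spectra and entanglement polytopes*, PhD thesis
  (2018), §2.3 "Examples. Tensors" (`k`-tensors `F^{n₁} ⊗ ⋯ ⊗ F^{n_k}`). [Zuiddam2018]
* V. Strassen, *The asymptotic spectrum of tensors*, J. reine angew. Math. 384 (1988). [Strassen1988]

## Design notes

* All `d` legs carry the SAME index type (`Fin d → ι`), as in the consumers' `(Fin d → Fin n) → K`;
  a general format `ι₀ × ⋯ × ι_{d-1}` embeds by padding with zeros, which does not change the class.
  TODO(general form): dependent formats `(j : Fin d) → ι j`.
* Several statements need a leg to exist (`[NeZero d]`): for `d = 0` every format is a scalar.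
* No instances, no notation: bare definitions and lemmas in the namespace `DTensor`. The only tree
  import is `TensorSemiring.lean`, for its block-diagonal matrices `blockDiag` (reused, not restated);
  the `d = 3` dictionary `DTensor.Restricts` ↔ `TensorRestrictsTo` (curried 3-tensors) is not needed by
  the consumers and is not formalised here — TODO(bridge).
-/

open scoped BigOperators

namespace Literature.Computability.AlgebraicComplexity

universe u

namespace DTensor

variable {K : Type u} [CommSemiring K] {d : ℕ}
variable {ι ι' ι'' κ κ' : Type*}

/-! ## The action of a leg-wise family of matrices -/

/-- Apply a family of matrices `A j : ι' × ι → K` (one per leg `j : Fin d`) to a `d`-tensor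
`t : (Fin d → ι) → K`: `(A · t) i = ∑_k (∏_j A j (i j) (k j)) · t k` — the coordinate form of
`(A₀ ⊗ ⋯ ⊗ A_{d-1}) t`, i.e. of CVZ's `f ∘ (A₁, …, A_k)`. [cite: ChristandlVranaZuiddam2023, §1.1] -/
def apply [Fintype ι] (A : Fin d → ι' → ι → K) (t : (Fin d → ι) → K) : (Fin d → ι') → K :=
  fun i => ∑ k : Fin d → ι, (∏ j, A j (i j) (k j)) * t k

/-- Unfolding of `apply`. [cite: ChristandlVranaZuiddam2023, §1.1] -/
theorem apply_apply_eq [Fintype ι] (A : Fin d → ι' → ι → K) (t : (Fin d → ι) → K)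
    (i : Fin d → ι') : apply A t i = ∑ k : Fin d → ι, (∏ j, A j (i j) (k j)) * t k := rfl

/-- A product of Kronecker deltas over the legs is the Kronecker delta of the multi-indices:
`∏_j [k j = k₀ j] · c = [k = k₀] · c`. [cite: ChristandlVranaZuiddam2023, §1.1] -/
theorem prod_ite_eq_eq [DecidableEq ι] (k k₀ : Fin d → ι) (c : K) :
    (∏ j, if k j = k₀ j then (1 : K) else 0) * c = if k = k₀ then c else 0 := by
  rw [Fintype.prod_boole]
  by_cases h : k = k₀
  · simp [h]
  · have : ¬ ∀ j, k j = k₀ j := fun h' => h (funext h')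
    simp [h, this]

/-- Identity matrices act as the identity: `(1 ⊗ ⋯ ⊗ 1) t = t`. [cite: ChristandlVranaZuiddam2023, §1.1] -/
theorem apply_one [Fintype ι] [DecidableEq ι] (t : (Fin d → ι) → K) :
    apply (fun _ (a : ι) (b : ι) => if b = a then (1 : K) else 0) t = t := by
  funext i
  rw [apply_apply_eq]
  simp_rw [prod_ite_eq_eq _ i]
  rw [Finset.sum_ite_eq' Finset.univ i]
  simp

/-- **Functoriality** (`(A ∘ B)·t = A·(B·t)` leg-wise): applying `A` after `B` is applying the
leg-wise matrix products `A j * B j`. [cite: ChristandlVranaZuiddam2023, §1.1] -/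
theorem apply_apply [Fintype ι] [Fintype ι'] (A : Fin d → ι'' → ι' → K) (B : Fin d → ι' → ι → K)
    (t : (Fin d → ι) → K) :
    apply A (apply B t) = apply (fun j a c => ∑ b, A j a b * B j b c) t := by
  funext i
  simp only [apply_apply_eq]
  simp_rw [Fintype.prod_sum (fun j b => A j (i j) b * B j b _)]
  simp only [Finset.mul_sum, Finset.sum_mul, Finset.prod_mul_distrib]
  rw [Finset.sum_comm]
  refine Finset.sum_congr rfl fun k _ => Finset.sum_congr rfl fun k' _ => ?_
  ring

/-- `apply A` is additive in the tensor. [cite: ChristandlVranaZuiddam2023, §1.1] -/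
theorem apply_add [Fintype ι] (A : Fin d → ι' → ι → K) (s t : (Fin d → ι) → K) :
    apply A (s + t) = apply A s + apply A t := by
  funext i
  simp only [apply_apply_eq, Pi.add_apply, mul_add, Finset.sum_add_distrib]

/-- `apply A 0 = 0`. [cite: ChristandlVranaZuiddam2023, §1.1] -/
theorem apply_zero [Fintype ι] (A : Fin d → ι' → ι → K) :
    apply A (0 : (Fin d → ι) → K) = 0 := by
  funext i
  simp [apply_apply_eq]

/-- Zero matrices act by zero as soon as there is a leg (`d ≠ 0`). [cite: ChristandlVranaZuiddam2023, §1.1] -/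
theorem apply_zero_left [Fintype ι] [NeZero d] (t : (Fin d → ι) → K) :
    apply (fun _ (_ : ι') (_ : ι) => (0 : K)) t = 0 := by
  funext i
  rw [apply_apply_eq]
  refine Finset.sum_eq_zero fun k _ => ?_
  rw [Finset.prod_eq_zero (Finset.mem_univ (0 : Fin d)) rfl, zero_mul]

/-! ## The restriction preorder -/

/-- **Restriction** of `d`-tensors: `Restricts t s` («`t ≥ s`», `t` restricts to `s`) iff
`s = (A₀ ⊗ ⋯ ⊗ A_{d-1}) t` for some family of matrices, i.e. `s = apply A t`
(CVZ: "We say `f` restricts to `g`, and write `f ≥ g`, if there are linear maps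
`A_i : 𝔽^{m_i} → 𝔽^{n_i}` such that `g = f ∘ (A₁, …, A_k)`"). [cite: ChristandlVranaZuiddam2023, §1.1] -/
def Restricts [Fintype ι] (t : (Fin d → ι) → K) (s : (Fin d → ι') → K) : Prop :=
  ∃ A : Fin d → ι' → ι → K, s = apply A t

/-- Restriction is reflexive ("Restriction `≥` … [is a] preorder"). [cite: ChristandlVranaZuiddam2023, §1.2] -/
theorem Restricts.refl [Fintype ι] [DecidableEq ι] (t : (Fin d → ι) → K) : Restricts t t :=
  ⟨_, (apply_one t).symm⟩

/-- Restriction is transitive (compose the maps leg-wise; "Restriction `≥` … [is a] preorder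
(reflexive and transitive)"). [cite: ChristandlVranaZuiddam2023, §1.2] -/
theorem Restricts.trans [Fintype ι] [Fintype ι'] {t : (Fin d → ι) → K} {s : (Fin d → ι') → K}
    {p : (Fin d → ι'') → K} (hts : Restricts t s) (hsp : Restricts s p) : Restricts t p := by
  obtain ⟨B, rfl⟩ := hts
  obtain ⟨A, rfl⟩ := hsp
  exact ⟨_, apply_apply A B t⟩

/-- `apply A t` is a restriction of `t` (by definition). [cite: ChristandlVranaZuiddam2023, §1.1] -/
theorem restricts_apply [Fintype ι] (A : Fin d → ι' → ι → K) (t : (Fin d → ι) → K) :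
    Restricts t (apply A t) :=
  ⟨A, rfl⟩

/-- Every tensor restricts to the zero tensor of any format (as soon as there is a leg; CVZ §1.2:
the "null maps" `f₀ : x ↦ 0`). [cite: ChristandlVranaZuiddam2023, §1.2] -/
theorem Restricts.zero [Fintype ι] [NeZero d] (t : (Fin d → ι) → K) :
    Restricts t (0 : (Fin d → ι') → K) :=
  ⟨_, (apply_zero_left t).symm⟩

/-- Only zero tensors are restrictions of a zero tensor. [cite: ChristandlVranaZuiddam2023, §1.2] -/
theorem Restricts.eq_zero_of_zero [Fintype ι] {s : (Fin d → ι') → K}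
    (h : Restricts (0 : (Fin d → ι) → K) s) : s = 0 := by
  obtain ⟨A, rfl⟩ := h
  exact apply_zero A

/-! ## Matrices of maps of index sets (the embedding calculus) -/

/-- The `0/1` matrix `E_f : κ × ι → K` of a map of index sets `f : ι → κ` (`E_f x a = [x = f a]`):
acting by it on every leg pushes a tensor forward along `f` (zero outside the image).
[cite: ChristandlVranaZuiddam2023, §1.1] -/
def embedMat (f : ι → κ) [DecidableEq κ] : κ → ι → K :=
  fun x a => if x = f a then 1 else 0

/-- Entries of `E_f`. [cite: ChristandlVranaZuiddam2023, §1.1] -/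
@[simp] theorem embedMat_apply (f : ι → κ) [DecidableEq κ] (x : κ) (a : ι) :
    (embedMat f x a : K) = if x = f a then 1 else 0 := rfl

/-- **`E_g · (E_f · t) = E_{g ∘ f} · t`** (leg-wise `E_g E_f = E_{g ∘ f}`). [cite: ChristandlVranaZuiddam2023, §1.1] -/
theorem apply_embedMat_apply_embedMat [Fintype ι] [Fintype κ] [DecidableEq κ] [DecidableEq κ']
    (g : κ → κ') (f : ι → κ) (t : (Fin d → ι) → K) :
    apply (fun _ => embedMat g) (apply (fun _ => embedMat f) t) =
      apply (fun _ => embedMat (K := K) (g ∘ f)) t := by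
  rw [apply_apply]
  congr 1
  funext j x a
  simp only [embedMat_apply, Function.comp_apply, mul_ite, mul_one, mul_zero]
  rw [Finset.sum_ite_eq' Finset.univ (f a)]
  simp

/-- **`E_f · t` in closed form on the image**: `(E_f · t) (f ∘ k) = t k` for `f` injective.
[cite: ChristandlVranaZuiddam2023, §1.1] -/
theorem apply_embedMat_comp [Fintype ι] [DecidableEq κ] {f : ι → κ} (hf : Function.Injective f)
    (t : (Fin d → ι) → K) (k : Fin d → ι) :
    apply (fun _ => embedMat (K := K) f) t (fun j => f (k j)) = t k := by
  classical
  rw [apply_apply_eq]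
  have h : ∀ k₁ : Fin d → ι, (∏ j, (embedMat (K := K) f (f (k j)) (k₁ j))) * t k₁ =
      if k₁ = k then t k₁ else 0 := fun k₁ => by
    simp only [embedMat_apply, hf.eq_iff, eq_comm (a := k _)]
    exact prod_ite_eq_eq k₁ k (t k₁)
  simp_rw [h]
  rw [Finset.sum_ite_eq' Finset.univ k]
  simp

/-- `E_f · t` vanishes at multi-indices with an entry outside the image of `f` (`d`-tensor version of
"zero outside the block"). [cite: ChristandlVranaZuiddam2023, §1.1] -/
theorem apply_embedMat_eq_zero [Fintype ι] [DecidableEq κ] (f : ι → κ) (t : (Fin d → ι) → K)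
    (i : Fin d → κ) {j₀ : Fin d} (hj : ∀ a, i j₀ ≠ f a) :
    apply (fun _ => embedMat (K := K) f) t i = 0 := by
  rw [apply_apply_eq]
  refine Finset.sum_eq_zero fun k _ => ?_
  rw [Finset.prod_eq_zero (Finset.mem_univ j₀) (by simp [hj (k j₀)]), zero_mul]

/-- A left inverse undoes an embedding: `E_g · (E_f · t) = t` when `g ∘ f = id`. [cite: ChristandlVranaZuiddam2023, §1.1] -/
theorem apply_embedMat_eq_self_of_leftInverse [Fintype ι] [Fintype κ] [DecidableEq ι]
    [DecidableEq κ] {g : κ → ι} {f : ι → κ} (h : Function.LeftInverse g f)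
    (t : (Fin d → ι) → K) :
    apply (fun _ => embedMat g) (apply (fun _ => embedMat (K := K) f) t) = t := by
  rw [apply_embedMat_apply_embedMat]
  have e : (g ∘ f) = id := funext h
  have e' : (fun _ : Fin d => embedMat (K := K) (g ∘ f)) = fun _ (a : ι) (b : ι) => if b = a then (1 : K) else 0 := by
    funext j a b
    rw [e, embedMat_apply, id_eq]
    simp only [eq_comm]
  rw [e']
  exact apply_one t

/-- **Precomposition is a restriction**: `t ≥ (i ↦ t (f ∘ i))` for any map of index sets `f : κ → ι`
(act by the transposed matrices `[b = f a]`). [cite: ChristandlVranaZuiddam2023, §1.1] -/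
theorem apply_coembedMat [Fintype ι] [DecidableEq ι] (f : κ → ι) (t : (Fin d → ι) → K) :
    apply (fun _ (a : κ) (b : ι) => if b = f a then (1 : K) else 0) t = fun i => t (fun j => f (i j)) := by
  funext i
  rw [apply_apply_eq]
  simp_rw [prod_ite_eq_eq _ (fun j => f (i j))]
  rw [Finset.sum_ite_eq' Finset.univ]
  simp

/-- `t` restricts to `t ∘ (f ∘ ·)` for every `f : κ → ι`. [cite: ChristandlVranaZuiddam2023, §1.1] -/
theorem restricts_precomp [Fintype ι] [DecidableEq ι] (f : κ → ι) (t : (Fin d → ι) → K) :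
    Restricts t (fun i : Fin d → κ => t (fun j => f (i j))) :=
  ⟨_, (apply_coembedMat f t).symm⟩

/-! ## Relabelling the legs -/

/-- Relabel every leg of a tensor along `e : ι ≃ ι'` (CVZ's isomorphic tensors: "bijective linear maps
`A_i`"). [cite: ChristandlVranaZuiddam2023, §1.2] -/
def reindex (e : ι ≃ ι') (t : (Fin d → ι) → K) : (Fin d → ι') → K :=
  fun i => t (fun j => e.symm (i j))

omit [CommSemiring K] in
/-- Entries of a relabelled tensor. [cite: ChristandlVranaZuiddam2023, §1.2] -/
@[simp] theorem reindex_apply (e : ι ≃ ι') (t : (Fin d → ι) → K) (i : Fin d → ι') :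
    reindex e t i = t (fun j => e.symm (i j)) := rfl

/-- Relabelling is the action of the permutation matrices `E_e`. [cite: ChristandlVranaZuiddam2023, §1.2] -/
theorem reindex_eq_apply_embedMat [Fintype ι] [DecidableEq ι'] (e : ι ≃ ι') (t : (Fin d → ι) → K) :
    reindex e t = apply (fun _ => embedMat (K := K) e) t := by
  classical
  funext i
  rw [apply_apply_eq, reindex_apply]
  have h : ∀ k : Fin d → ι, (∏ j, (embedMat (K := K) (⇑e) (i j) (k j))) * t k =
      if k = (fun j => e.symm (i j)) then t k else 0 := fun k => by
    have : ∀ j, (i j = e (k j)) = (k j = e.symm (i j)) := fun j =>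
      propext ⟨fun h => by simp [h], fun h => by simp [h]⟩
    simp only [embedMat_apply, this]
    exact prod_ite_eq_eq k _ (t k)
  simp_rw [h]
  rw [Finset.sum_ite_eq' Finset.univ]
  simp

/-- A tensor restricts to each of its relabellings. [cite: ChristandlVranaZuiddam2023, §1.2] -/
theorem restricts_reindex [Fintype ι] [DecidableEq ι'] (e : ι ≃ ι') (t : (Fin d → ι) → K) :
    Restricts t (reindex e t) :=
  ⟨_, reindex_eq_apply_embedMat e t⟩

omit [CommSemiring K] in
/-- Relabelling back. [cite: ChristandlVranaZuiddam2023, §1.2] -/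
theorem reindex_symm_reindex (e : ι ≃ ι') (t : (Fin d → ι) → K) :
    reindex e.symm (reindex e t) = t := by
  funext i; simp

omit [CommSemiring K] in
/-- Relabelling along a composite. [cite: ChristandlVranaZuiddam2023, §1.2] -/
theorem reindex_reindex (e : ι ≃ ι') (e' : ι' ≃ ι'') (t : (Fin d → ι) → K) :
    reindex e' (reindex e t) = reindex (e.trans e') t := by
  funext i; simp

/-- Each relabelling restricts to the original tensor. [cite: ChristandlVranaZuiddam2023, §1.2] -/
theorem reindex_restricts [Fintype ι] [Fintype ι'] [DecidableEq ι] (e : ι ≃ ι')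
    (t : (Fin d → ι) → K) : Restricts (reindex e t) t := by
  have h := restricts_reindex e.symm (reindex e t)
  rwa [reindex_symm_reindex] at h

/-- Restriction is invariant under relabelling the source … [cite: ChristandlVranaZuiddam2023, §1.2] -/
theorem Restricts.reindex_left_iff [Fintype ι] [Fintype ι'] [DecidableEq ι] [DecidableEq ι']
    [Fintype κ] (e : ι ≃ ι') {t : (Fin d → ι) → K} {s : (Fin d → κ) → K} :
    Restricts (DTensor.reindex e t) s ↔ Restricts t s :=
  ⟨fun h => (restricts_reindex e t).trans h, fun h => (reindex_restricts e t).trans h⟩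

/-- … and the target. [cite: ChristandlVranaZuiddam2023, §1.2] -/
theorem Restricts.reindex_right_iff [Fintype ι] [Fintype κ] [Fintype κ'] [DecidableEq κ]
    [DecidableEq κ'] (e : κ ≃ κ') {t : (Fin d → ι) → K} {s : (Fin d → κ) → K} :
    Restricts t (DTensor.reindex e s) ↔ Restricts t s :=
  ⟨fun h => h.trans (reindex_restricts e s), fun h => h.trans (restricts_reindex e s)⟩

/-- Relabelling an action: `reindex e (E_f · t) = E_{e ∘ f} · t`. [cite: ChristandlVranaZuiddam2023, §1.2] -/
theorem reindex_apply_embedMat [Fintype ι] [Fintype κ] [DecidableEq κ] [DecidableEq κ'] (e : κ ≃ κ')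
    (f : ι → κ) (t : (Fin d → ι) → K) :
    reindex e (apply (fun _ => embedMat (K := K) f) t) = apply (fun _ => embedMat (K := K) (e ∘ f)) t := by
  rw [reindex_eq_apply_embedMat, apply_embedMat_apply_embedMat]

/-! ## Kronecker product, direct sum, unit tensors -/

/-- The **Kronecker (tensor) product** of `d`-tensors, leg-wise product of index sets:
`(t ⊗ t') i = t (fst ∘ i) · t' (snd ∘ i)` (CVZ: "`(v₁ ⊗ w₁, …, v_k ⊗ w_k) ↦ f(v₁,…,v_k) g(w₁,…,w_k)`").
[cite: ChristandlVranaZuiddam2023, §1.1] -/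
def kron (t : (Fin d → ι) → K) (t' : (Fin d → ι') → K) : (Fin d → ι × ι') → K :=
  fun i => t (fun j => (i j).1) * t' (fun j => (i j).2)

/-- Entries of the Kronecker product. [cite: ChristandlVranaZuiddam2023, §1.1] -/
@[simp] theorem kron_apply (t : (Fin d → ι) → K) (t' : (Fin d → ι') → K) (i : Fin d → ι × ι') :
    kron t t' i = t (fun j => (i j).1) * t' (fun j => (i j).2) := rfl

/-- `⊗` is additive on the right. [cite: ChristandlVranaZuiddam2023, §1.1] -/
theorem kron_add (t : (Fin d → ι) → K) (s s' : (Fin d → ι') → K) :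
    kron t (s + s') = kron t s + kron t s' := by
  funext i; simp [mul_add]

/-- `⊗` is additive on the left. [cite: ChristandlVranaZuiddam2023, §1.1] -/
theorem add_kron (t t' : (Fin d → ι) → K) (s : (Fin d → ι') → K) :
    kron (t + t') s = kron t s + kron t' s := by
  funext i; simp [add_mul]

/-- The **direct sum** of `d`-tensors, leg-wise disjoint union of index sets: `t` on the block
`inl ∘ k`, `t'` on the block `inr ∘ k'`, zero at mixed positions (CVZ: "`(v₁ + w₁, …, v_k + w_k) ↦
f(v₁,…,v_k) + g(w₁,…,w_k)`") — written in closed form as `E_inl · t + E_inr · t'`.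
[cite: ChristandlVranaZuiddam2023, §1.1] -/
def dsum [Fintype ι] [Fintype ι'] [DecidableEq ι] [DecidableEq ι'] (t : (Fin d → ι) → K)
    (t' : (Fin d → ι') → K) : (Fin d → ι ⊕ ι') → K :=
  apply (fun _ => embedMat Sum.inl) t + apply (fun _ => embedMat Sum.inr) t'

/-- Unfolding of `dsum`. [cite: ChristandlVranaZuiddam2023, §1.1] -/
theorem dsum_def [Fintype ι] [Fintype ι'] [DecidableEq ι] [DecidableEq ι'] (t : (Fin d → ι) → K)
    (t' : (Fin d → ι') → K) :
    dsum t t' = apply (fun _ => embedMat Sum.inl) t + apply (fun _ => embedMat Sum.inr) t' := rfl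

/-- The direct sum on the first block. [cite: ChristandlVranaZuiddam2023, §1.1] -/
theorem dsum_inl [Fintype ι] [Fintype ι'] [DecidableEq ι] [DecidableEq ι'] [NeZero d]
    (t : (Fin d → ι) → K) (t' : (Fin d → ι') → K) (k : Fin d → ι) :
    dsum t t' (fun j => Sum.inl (k j)) = t k := by
  rw [dsum_def, Pi.add_apply, apply_embedMat_comp Sum.inl_injective,
    apply_embedMat_eq_zero (j₀ := 0) Sum.inr t' _ (fun b => by simp), add_zero]

/-- The direct sum on the second block. [cite: ChristandlVranaZuiddam2023, §1.1] -/
theorem dsum_inr [Fintype ι] [Fintype ι'] [DecidableEq ι] [DecidableEq ι'] [NeZero d]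
    (t : (Fin d → ι) → K) (t' : (Fin d → ι') → K) (k : Fin d → ι') :
    dsum t t' (fun j => Sum.inr (k j)) = t' k := by
  rw [dsum_def, Pi.add_apply, apply_embedMat_comp Sum.inr_injective,
    apply_embedMat_eq_zero (j₀ := 0) Sum.inl t _ (fun a => by simp), zero_add]

/-- The direct sum vanishes at mixed positions (one leg in each block). [cite: ChristandlVranaZuiddam2023, §1.1] -/
theorem dsum_mixed [Fintype ι] [Fintype ι'] [DecidableEq ι] [DecidableEq ι']
    (t : (Fin d → ι) → K) (t' : (Fin d → ι') → K) (i : Fin d → ι ⊕ ι') {j₁ j₂ : Fin d} {a : ι}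
    {b : ι'} (h₁ : i j₁ = Sum.inl a) (h₂ : i j₂ = Sum.inr b) : dsum t t' i = 0 := by
  rw [dsum_def, Pi.add_apply, apply_embedMat_eq_zero (j₀ := j₂) Sum.inl t i (fun a' => by simp [h₂]),
    apply_embedMat_eq_zero (j₀ := j₁) Sum.inr t' i (fun b' => by simp [h₁]), add_zero]

/-- **Relabelling a direct sum** along `e : ι ⊕ ι' ≃ κ`: `reindex e (t ⊕ t') = E_{e ∘ inl} t + E_{e ∘ inr} t'`.
[cite: ChristandlVranaZuiddam2023, §1.1] -/
theorem reindex_dsum [Fintype ι] [Fintype ι'] [DecidableEq ι] [DecidableEq ι'] [DecidableEq κ]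
    (e : ι ⊕ ι' ≃ κ) (t : (Fin d → ι) → K) (t' : (Fin d → ι') → K) :
    reindex e (dsum t t') = apply (fun _ => embedMat (K := K) (e ∘ Sum.inl)) t +
      apply (fun _ => embedMat (K := K) (e ∘ Sum.inr)) t' := by
  rw [dsum_def, reindex_eq_apply_embedMat, apply_add, apply_embedMat_apply_embedMat,
    apply_embedMat_apply_embedMat]

/-- Acting by an embedding on a direct sum distributes over the blocks:
`E_g (t ⊕ t') = E_{g ∘ inl} t + E_{g ∘ inr} t'`. [cite: ChristandlVranaZuiddam2023, §1.1] -/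
theorem apply_embedMat_dsum [Fintype ι] [Fintype ι'] [DecidableEq ι] [DecidableEq ι']
    [DecidableEq κ] (g : ι ⊕ ι' → κ) (t : (Fin d → ι) → K) (t' : (Fin d → ι') → K) :
    apply (fun _ => embedMat (K := K) g) (dsum t t') = apply (fun _ => embedMat (K := K) (g ∘ Sum.inl)) t +
      apply (fun _ => embedMat (K := K) (g ∘ Sum.inr)) t' := by
  rw [dsum_def, apply_add, apply_embedMat_apply_embedMat, apply_embedMat_apply_embedMat]

variable (K d) in
/-- The **unit tensor** `⟨|ι|⟩ = ∑_a e_a ⊗ ⋯ ⊗ e_a` on the index set `ι`: `1` on constant multi-indices,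
`0` elsewhere (CVZ: "`⟨n⟩` … maps `(e_{i₁}, …, e_{i_k})` to `1` if `i₁ = ⋯ = i_k` and to `0`
otherwise"). [cite: ChristandlVranaZuiddam2023, §1.1] -/
def unit (ι : Type*) [DecidableEq ι] : (Fin d → ι) → K :=
  fun i => if ∀ j j', i j = i j' then 1 else 0

/-- Entries of the unit tensor. [cite: ChristandlVranaZuiddam2023, §1.1] -/
theorem unit_apply [DecidableEq ι] (i : Fin d → ι) :
    unit K d ι i = if ∀ j j', i j = i j' then (1 : K) else 0 := rfl

omit [CommSemiring K] in
/-- A multi-index is constant iff it is `Function.const _ c` for some `c` — and then for exactly one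
`c`, as soon as there is a leg. [cite: ChristandlVranaZuiddam2023, §1.1] -/
theorem forall_eq_iff_exists_const [NeZero d] (i : Fin d → ι) :
    (∀ j j', i j = i j') ↔ ∃ c, i = fun _ => c :=
  ⟨fun h => ⟨i 0, funext fun j => h j 0⟩, fun ⟨c, hc⟩ j j' => by simp [hc]⟩

/-- **The unit tensor as a sum of elementary tensors**: `⟨ι⟩ i = ∑_c ∏_j [i j = c]` (`d ≠ 0`).
[cite: ChristandlVranaZuiddam2023, §1.1] -/
theorem unit_eq_sum [Fintype ι] [DecidableEq ι] [NeZero d] (i : Fin d → ι) :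
    unit K d ι i = ∑ c : ι, ∏ j, if i j = c then (1 : K) else 0 := by
  classical
  have h : ∀ c : ι, (∏ j, if i j = c then (1 : K) else 0) = if i = fun _ => c then 1 else 0 := fun c => by
    have := prod_ite_eq_eq (K := K) i (fun _ => c) 1
    rwa [mul_one] at this
  simp_rw [h, unit_apply]
  by_cases hi : ∀ j j', i j = i j'
  · obtain ⟨c, rfl⟩ := (forall_eq_iff_exists_const i).1 hi
    rw [if_pos hi, Finset.sum_eq_single c]
    · simp
    · intro b _ hb
      rw [if_neg]
      intro h'
      exact hb (congrFun h' 0).symm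
    · simp
  · rw [if_neg hi]
    refine (Finset.sum_eq_zero fun c _ => ?_).symm
    rw [if_neg]
    intro h'
    exact hi ((forall_eq_iff_exists_const i).2 ⟨c, h'⟩)

/-- **The action on a unit tensor is a single sum**: `(A · ⟨ι⟩) i = ∑_c ∏_j A j (i j) c` (`d ≠ 0`).
[cite: ChristandlVranaZuiddam2023, §1.1] -/
theorem apply_unit [Fintype ι] [DecidableEq ι] [NeZero d] (A : Fin d → ι' → ι → K)
    (i : Fin d → ι') : apply A (unit K d ι) i = ∑ c : ι, ∏ j, A j (i j) c := by
  classical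
  rw [apply_apply_eq]
  have h : ∀ k : Fin d → ι, (∏ j, A j (i j) (k j)) * unit K d ι k =
      ∑ c : ι, if k = fun _ => c then ∏ j, A j (i j) c else 0 := fun k => by
    rw [unit_apply]
    by_cases hk : ∀ j j', k j = k j'
    · obtain ⟨c, rfl⟩ := (forall_eq_iff_exists_const k).1 hk
      rw [if_pos hk, mul_one, Finset.sum_eq_single c]
      · simp
      · intro b _ hb
        rw [if_neg]
        intro h'
        exact hb (congrFun h' 0).symm
      · simp
    · rw [if_neg hk, mul_zero]
      refine (Finset.sum_eq_zero fun c _ => ?_).symm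
      rw [if_neg]
      intro h'
      exact hk ((forall_eq_iff_exists_const k).2 ⟨c, h'⟩)
  simp_rw [h]
  rw [Finset.sum_comm]
  refine Finset.sum_congr rfl fun c _ => ?_
  rw [Finset.sum_ite_eq' Finset.univ]
  simp

/-- **Embedding a unit tensor**: `E_f · ⟨ι⟩ = (i ↦ ∑_a ∏_j [i j = f a])` (`d ≠ 0`).
[cite: ChristandlVranaZuiddam2023, §1.1] -/
theorem apply_embedMat_unit [Fintype ι] [DecidableEq ι] [DecidableEq κ] [NeZero d] (f : ι → κ)
    (i : Fin d → κ) :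
    apply (fun _ => embedMat (K := K) f) (unit K d ι) i = ∑ a : ι, ∏ j, if i j = f a then (1 : K) else 0 := by
  rw [apply_unit]
  rfl

/-- **`⟨ι⟩ ⊕ ⟨ι'⟩ = ⟨ι ⊕ ι'⟩`** on the nose (`d ≠ 0`). [cite: ChristandlVranaZuiddam2023, §1.1] -/
theorem dsum_unit_unit [Fintype ι] [Fintype ι'] [DecidableEq ι] [DecidableEq ι'] [NeZero d] :
    dsum (unit K d ι) (unit K d ι') = unit K d (ι ⊕ ι') := by
  funext i
  rw [dsum_def, Pi.add_apply, apply_embedMat_unit, apply_embedMat_unit, unit_eq_sum,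
    Fintype.sum_sum_type]

/-- **`⟨ι⟩ ⊗ ⟨ι'⟩ = ⟨ι × ι'⟩`** on the nose. [cite: ChristandlVranaZuiddam2023, §1.1] -/
theorem kron_unit_unit [DecidableEq ι] [DecidableEq ι'] :
    kron (unit K d ι) (unit K d ι') = unit K d (ι × ι') := by
  funext i
  rw [kron_apply, unit_apply, unit_apply, unit_apply]
  by_cases h : ∀ j j', i j = i j'
  · rw [if_pos h, if_pos (fun j j' => by rw [h j j']), if_pos (fun j j' => by rw [h j j']), mul_one]
  · rw [if_neg h]
    by_cases h₁ : ∀ j j', (i j).1 = (i j').1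
    · rw [if_pos h₁, one_mul, if_neg]
      intro h₂
      exact h fun j j' => Prod.ext (h₁ j j') (h₂ j j')
    · rw [if_neg h₁, zero_mul]

omit [CommSemiring K] in
/-- **Relabelling a unit tensor gives the unit tensor**: `reindex e ⟨ι⟩ = ⟨ι'⟩`.
[cite: ChristandlVranaZuiddam2023, §1.1] -/
theorem reindex_unit {K : Type u} [CommSemiring K] [DecidableEq ι] [DecidableEq ι'] (e : ι ≃ ι') :
    reindex e (unit K d ι) = unit K d ι' := by
  funext i
  simp only [reindex_apply, unit_apply, e.symm.injective.eq_iff]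

/-- **Composing with an injection of index sets preserves the unit tensor**:
`⟨ι⟩ (f ∘ i) = ⟨κ⟩ i` for `f : κ → ι` injective. [cite: ChristandlVranaZuiddam2023, §1.1] -/
theorem unit_comp_of_injective [DecidableEq ι] [DecidableEq κ] {f : κ → ι}
    (hf : Function.Injective f) (i : Fin d → κ) :
    unit K d ι (fun j => f (i j)) = unit K d κ i := by
  simp only [unit_apply, hf.eq_iff]

/-- **`⟨ι⟩ ≥ ⟨κ⟩` for an injection `κ ↪ ι`** (CVZ §1.2: "naturally `n ≥ m` if … `⟨n⟩ ≥ ⟨m⟩`", the easy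
direction). [cite: ChristandlVranaZuiddam2023, §1.2] -/
theorem restricts_unit_of_injective [Fintype ι] [DecidableEq ι] [DecidableEq κ] {f : κ → ι}
    (hf : Function.Injective f) : Restricts (unit K d ι) (unit K d κ) := by
  have h := restricts_precomp f (unit K d ι)
  simp_rw [unit_comp_of_injective hf] at h
  exact h

/-! ## Compatibility of restriction with the operations -/

omit [CommSemiring K] in
/-- Precomposing the multi-index with a map of index sets moves into the matrices
(definitional). [cite: ChristandlVranaZuiddam2023, §1.1] -/
theorem apply_comp_index {K : Type u} [CommSemiring K] [Fintype ι] (A : Fin d → ι' → ι → K)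
    (t : (Fin d → ι) → K) (f : ι'' → ι') (i : Fin d → ι'') :
    apply A t (fun j => f (i j)) = apply (fun j x y => A j (f x) y) t i := rfl

/-- `apply` commutes with Kronecker products: `(A ⊗ A') · (t ⊗ t') = (A · t) ⊗ (A' · t')`, where
`(A ⊗ A') j (x, x') (y, y') = A j x y * A' j x' y'`. [cite: ChristandlVranaZuiddam2023, §1.1] -/
theorem apply_kron [Fintype ι] [Fintype ι'] (A : Fin d → κ → ι → K) (A' : Fin d → κ' → ι' → K)
    (t : (Fin d → ι) → K) (t' : (Fin d → ι') → K) :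
    apply (fun j (x : κ × κ') (y : ι × ι') => A j x.1 y.1 * A' j x.2 y.2) (kron t t') =
      kron (apply A t) (apply A' t') := by
  funext i
  rw [kron_apply, apply_apply_eq, apply_apply_eq, apply_apply_eq, Finset.sum_mul_sum,
    ← (Equiv.arrowProdEquivProdArrow (Fin d) (fun _ => ι) (fun _ => ι')).symm.sum_comp]
  simp only [Fintype.sum_prod_type]
  refine Finset.sum_congr rfl fun k _ => Finset.sum_congr rfl fun k' _ => ?_
  simp only [Equiv.arrowProdEquivProdArrow, Equiv.coe_fn_symm_mk, kron_apply,
    Finset.prod_mul_distrib]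
  ring

/-- **Restriction is compatible with the Kronecker product** (`t ≥ s`, `t' ≥ s'` ⇒ `t ⊗ t' ≥ s ⊗ s'`;
CVZ §1.2: `≥` "behave[s] well with respect to the semiring operations"). [cite: ChristandlVranaZuiddam2023, §1.2] -/
theorem Restricts.kron [Fintype ι] [Fintype ι'] {t : (Fin d → ι) → K} {s : (Fin d → κ) → K}
    {t' : (Fin d → ι') → K} {s' : (Fin d → κ') → K} (h : Restricts t s) (h' : Restricts t' s') :
    Restricts (kron t t') (kron s s') := by
  obtain ⟨A, rfl⟩ := h
  obtain ⟨A', rfl⟩ := h'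
  exact ⟨_, (apply_kron A A' t t').symm⟩

/-- `t ⊗ (A' · t') = (1 ⊗ A') · (t ⊗ t')`: acting on the second factor only. [cite: ChristandlVranaZuiddam2023, §1.1] -/
theorem kron_apply_right [Fintype ι] [Fintype ι'] [DecidableEq ι] (t : (Fin d → ι) → K)
    (A' : Fin d → κ' → ι' → K) (t' : (Fin d → ι') → K) :
    kron t (apply A' t') =
      apply (fun j (x : ι × κ') (y : ι × ι') => (if y.1 = x.1 then (1 : K) else 0) * A' j x.2 y.2)
        (kron t t') := by
  have h := apply_kron (fun _ (a : ι) (b : ι) => if b = a then (1 : K) else 0) A' t t'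
  rw [apply_one] at h
  exact h.symm

/-- `(A · t) ⊗ t' = (A ⊗ 1) · (t ⊗ t')`: acting on the first factor only. [cite: ChristandlVranaZuiddam2023, §1.1] -/
theorem kron_apply_left [Fintype ι] [Fintype ι'] [DecidableEq ι'] (A : Fin d → κ → ι → K)
    (t : (Fin d → ι) → K) (t' : (Fin d → ι') → K) :
    kron (apply A t) t' =
      apply (fun j (x : κ × ι') (y : ι × ι') => A j x.1 y.1 * (if y.2 = x.2 then (1 : K) else 0))
        (kron t t') := by
  have h := apply_kron A (fun _ (a : ι') (b : ι') => if b = a then (1 : K) else 0) t t'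
  rw [apply_one] at h
  exact h.symm

/-- `t ⊗ (E_f · t') = E_{id × f} · (t ⊗ t')`. [cite: ChristandlVranaZuiddam2023, §1.1] -/
theorem kron_apply_embedMat [Fintype ι] [Fintype ι'] [DecidableEq ι] [DecidableEq κ'] (t : (Fin d → ι) → K)
    (f : ι' → κ') (t' : (Fin d → ι') → K) :
    kron t (apply (fun _ => embedMat (K := K) f) t') =
      apply (fun _ => embedMat (K := K) (Prod.map id f)) (kron t t') := by
  rw [kron_apply_right]
  congr 1
  funext j x y
  obtain ⟨x₁, x₂⟩ := x
  obtain ⟨y₁, y₂⟩ := y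
  simp only [embedMat_apply, Prod.map_apply, id_eq, Prod.mk.injEq]
  by_cases h₁ : x₁ = y₁
  · subst h₁
    by_cases h₂ : x₂ = f y₂ <;> simp [h₂]
  · have h₁' : ¬ y₁ = x₁ := fun h => h₁ h.symm
    by_cases h₂ : x₂ = f y₂ <;> simp [h₁, h₁', h₂]

/-- `(E_f · t) ⊗ t' = E_{f × id} · (t ⊗ t')`. [cite: ChristandlVranaZuiddam2023, §1.1] -/
theorem apply_embedMat_kron [Fintype ι] [Fintype ι'] [DecidableEq ι'] [DecidableEq κ] (f : ι → κ)
    (t : (Fin d → ι) → K) (t' : (Fin d → ι') → K) :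
    kron (apply (fun _ => embedMat (K := K) f) t) t' =
      apply (fun _ => embedMat (K := K) (Prod.map f id)) (kron t t') := by
  rw [kron_apply_left]
  congr 1
  funext j x y
  obtain ⟨x₁, x₂⟩ := x
  obtain ⟨y₁, y₂⟩ := y
  simp only [embedMat_apply, Prod.map_apply, id_eq, Prod.mk.injEq]
  by_cases h₂ : x₂ = y₂
  · subst h₂
    by_cases h₁ : x₁ = f y₁ <;> simp [h₁]
  · have h₂' : ¬ y₂ = x₂ := fun h => h₂ h.symm
    by_cases h₁ : x₁ = f y₁ <;> simp [h₁, h₂, h₂']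

/-- **Restriction is compatible with the direct sum** (`t ≥ s`, `t' ≥ s'` ⇒ `t ⊕ t' ≥ s ⊕ s'`, by the
leg-wise block-diagonal matrices `blockDiag` of the tree's `TensorSemiring.lean`; CVZ §1.2).
[cite: ChristandlVranaZuiddam2023, §1.2] -/
theorem Restricts.dsum [Fintype ι] [Fintype ι'] [Fintype κ] [Fintype κ'] [DecidableEq ι]
    [DecidableEq ι'] [DecidableEq κ] [DecidableEq κ'] {t : (Fin d → ι) → K}
    {s : (Fin d → κ) → K} {t' : (Fin d → ι') → K} {s' : (Fin d → κ') → K} (h : Restricts t s)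
    (h' : Restricts t' s') : Restricts (dsum t t') (dsum s s') := by
  obtain ⟨A, rfl⟩ := h
  obtain ⟨A', rfl⟩ := h'
  refine ⟨fun j => blockDiag (A j) (A' j), ?_⟩
  rw [dsum_def, dsum_def, apply_add, apply_apply, apply_apply, apply_apply, apply_apply]
  congr 2
  · funext j x c
    rcases x with a' | b' <;>
      simp [Finset.sum_ite_eq', Finset.sum_ite_eq]
  · funext j x c
    rcases x with a' | b' <;>
      simp [Finset.sum_ite_eq', Finset.sum_ite_eq]

end DTensor

end Literature.Computability.AlgebraicComplexity
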